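import Summits.QuantumFields.YangMills.Theorems.PoincareLipschitzSmallRangeOfOneStep
import Summits.QuantumFields.YangMills.Theorems.PoincareLipschitzSphereMapSmallRangeHolder
import HarnessLib

/-!
# Line «poincare_lipschitz» on crux `HistoryTailL` (stmt-QuantumFields-19936), K2 organ of record LOC-REG-MIN — E→R ROAD, THE E2E KNIT
# ‹ONE-STEP ENERGY IMPROVEMENT ⟹ HÖLDER RADIUS LAW›: the F6 door ✓`PoincareLipschitzSmallRangeOfOneStep.norm_sub_le_of_oneStep` («small normalised energy ⟹ small
# range») composed with px7 g5's ✓`PoincareLipschitzSphereMapSmallRangeHolder.smallRange_holder_law` («small range ⟹ `‖∇u(x₀)‖² ≤ C·ω²∕R`»)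

Cell `ym3-torus` (YM ladder rung R3 = continuum SU(2) Yang–Mills on the three-torus — a RUNG, NOT the Clay problem: not d = 4, not infinite volume, not a mass gap);
width seat `ym3-torus-px8` gen 5 (LEAD ym-ust-19936-w1 g8; px7 g5 2026-08-29 05:26:44Z «your E→R `osc` output plugs into `smallRange_holder_law`'s `ω` — binder:
`‖u y − p‖ ≤ ω` on `Q_{2R+1}(x₀)` for some unit `p`»).  THEOREMS ONLY (def-free); `--supports stmt-QuantumFields-19936 --as helper`.  ONE theorem, one `obtain` + two
`exact`s: it shows the two doors' letters MEET (`p := u x₀`, `ω :=` the F6 bound on `Q_{2R+1}(x₀)`), so that once brick F5 (the one-step improvement, ★w5-19936 g12's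
pen) is a theorem in the socket shape `hone` below, «SMALL NORMALISED ENERGY ⟹ HÖLDER RADIUS LAW» for one-site-optimal sphere-valued lattice maps is a kernel fact.
F5 is a HYPOTHESIS here; NOTHING of F5, E→R, LOC-REG-MIN, `hReg`, a stub, `BlockLipschitzL`, `HistoryTailL` or a summit statement is proved.

* ★★★ `smallEnergy_holder_law` — `V` finite-dimensional (px7's law needs it; the F6 half does not), `d ≥ 1`; with px7's `ω₀(d), C(d)`: for `u` unit-valued on
  `Q_{2R+1}(x₀)` and one-site optimal on `Q_{2R}(x₀)` (`R ≥ 1`), the F6 hypotheses at centre `x₀`, radius `ρ₀ = 2R+1` (ladder `m^K ≥ 2(2R+1)`, one-step improvement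
  `hone` at every centre of `Q_{2R+1}(x₀)`, top-scale bound `Etop` below the threshold `T`), and the SMALLNESS
  `ω := 17·√(16d8^d)·√(m^{d−1}·Etop∕(m^K)^{d−1}·(2(2R+1)+1)) ≤ ω₀` ⟹ `‖u(x₀+e_μ) − u x₀‖² ≤ C·ω²∕R` for every axis `μ`.
[folklore] ([Giaquinta1984] Ch. III Lemma 2.1, Thm 1.2; Ch. VI §1, §3; [SchoenUhlenbeck1982] §4 — the small-energy regularity scheme; lattice statements are the
imported files').
-/

set_option autoImplicit false

noncomputable section

open scoped BigOperators InnerProductSpace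
open Finset

namespace Summit.QuantumFields.YangMills.Theorems.PoincareLipschitzSmallEnergyHolderLaw

open Literature.MathematicalPhysics.QuantumFieldTheory.Balaban1983to89
open B4Eq19LatticeOperators
open Summit.QuantumFields.YangMills.Theorems.PoincareLipschitzSmallRangeOfOneStep (norm_sub_le_of_oneStep)
open Summit.QuantumFields.YangMills.Theorems.PoincareLipschitzSphereMapSmallRangeHolder (smallRange_holder_law)

variable {d : ℕ} {V : Type*} [NormedAddCommGroup V] [InnerProductSpace ℝ V]

/-- ★★★ **E2E KNIT ‹ONE-STEP ENERGY IMPROVEMENT ⟹ HÖLDER RADIUS LAW›** (F6 door ∘ px7's small-range Hölder law; see the module docstring for the reading).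
`ω₀, C` are px7's `smallRange_holder_law` constants; `ω` is the F6 door's oscillation bound on `Q_{2R+1}(x₀)`; the one-step improvement `hone` is brick F5's socket.
[folklore] [cite: Giaquinta1984, Ch. III Lemma 2.1 p.86, Thm 1.2 p.70; SchoenUhlenbeck1982, §4] -/
theorem smallEnergy_holder_law [FiniteDimensional ℝ V] (hd : 1 ≤ d) : ∃ ω₀ C : ℝ, 0 < ω₀ ∧ 0 < C ∧
    ∀ (u : Zd d → V) (E : Zd d → ℤ → ℝ) (T : ℤ → ℝ) (A ε : ℝ) (m K : ℕ) (x₀ : Zd d) (R : ℕ) (Etop : ℝ),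
      (∀ x ρ, E x ρ = ∑ y ∈ box x ρ, ∑ μ, ‖u (y + unitVec μ) - u y‖ ^ 2) →
      0 ≤ A → 2 ≤ m → (2 : ℝ) ^ (d + 1) * A ≤ m → ε ≤ 1 / 2 * ((m : ℝ) ^ (d - 1))⁻¹ → 1 ≤ R →
      2 * ((2 * R + 1 : ℕ) : ℤ) ≤ (m : ℤ) ^ K →
      (∀ k, k < K → ((m : ℝ) ^ (d - 1))⁻¹ * T ((m : ℤ) ^ (k + 1)) ≤ T ((m : ℤ) ^ k)) →
      -- F5's socket: the one-step energy improvement at every centre of `Q_{2R+1}(x₀)`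
      (∀ x ∈ box x₀ ((2 * R + 1 : ℕ) : ℤ), ∀ ρ r : ℤ, 1 ≤ ρ → ρ + 1 ≤ r → r ≤ (m : ℤ) ^ K → E x r ≤ T r →
        E x ρ ≤ (A * (((ρ : ℝ) + 1) / r) ^ d + ε) * E x r) →
      (∀ x ∈ box x₀ ((2 * R + 1 : ℕ) : ℤ), E x ((m : ℤ) ^ K) ≤ Etop) →
      (∀ x ∈ box x₀ ((2 * R + 1 : ℕ) : ℤ), E x ((m : ℤ) ^ K) ≤ T ((m : ℤ) ^ K)) →
      -- sphere-valued and one-site optimal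
      (∀ y ∈ box x₀ (2 * (R : ℤ) + 1), ‖u y‖ = 1) →
      (∀ y ∈ box x₀ (2 * (R : ℤ)), ‖∑ μ, (u (y + unitVec μ) + u (y - unitVec μ))‖ • u y = ∑ μ, (u (y + unitVec μ) + u (y - unitVec μ))) →
      -- smallness of the F6 range bound
      17 * Real.sqrt (16 * d * 8 ^ d) *
          Real.sqrt (((m : ℝ) ^ (d - 1) * Etop / ((m : ℝ) ^ K) ^ (d - 1)) * (2 * ((2 * R + 1 : ℕ) : ℝ) + 1)) ≤ ω₀ →
      ∀ μ : Fin d, ‖u (x₀ + unitVec μ) - u x₀‖ ^ 2 ≤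
        C * (17 * Real.sqrt (16 * d * 8 ^ d) *
          Real.sqrt (((m : ℝ) ^ (d - 1) * Etop / ((m : ℝ) ^ K) ^ (d - 1)) * (2 * ((2 * R + 1 : ℕ) : ℝ) + 1))) ^ 2 / R := by
  obtain ⟨ω₀, C, hω₀, hC, hlaw⟩ := smallRange_holder_law (V := V) hd
  refine ⟨ω₀, C, hω₀, hC, ?_⟩
  intro u E T A ε m K x₀ R Etop hE hA hm hmA hε hR hK hT hone htop hthr hu1 hopt hsmall μ
  -- the F6 door at centre `x₀`, radius `ρ₀ = 2R+1`
  have hρ₀ : 1 ≤ 2 * R + 1 := by omega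
  have hrange := norm_sub_le_of_oneStep hd u E hE T hA hm hmA hε K x₀ hρ₀ hK hT hone htop hthr
  -- px7's law with `p := u x₀`, `ω :=` the door's bound
  have hx₀ : x₀ ∈ box x₀ (2 * (R : ℤ) + 1) := self_mem_box x₀ (by positivity)
  have hp : ‖u x₀‖ = 1 := hu1 x₀ hx₀
  have hcast : (((2 * R + 1 : ℕ) : ℤ)) = 2 * (R : ℤ) + 1 := by push_cast; ring
  refine hlaw u (u x₀) x₀ R _ hR hp (by positivity) hsmall hu1 (fun y hy => ?_) hopt μ
  exact hrange y (by rw [hcast]; exact hy)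

end Summit.QuantumFields.YangMills.Theorems.PoincareLipschitzSmallEnergyHolderLaw

end
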